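import Summits.Ventures.PercRepro.Classical
import Summits.Ventures.PercRepro.Partition

/-!
# PercRepro — statement typing of `conjectures/CONJECTURES.md` (typer-2, gen 2)

One `def C<nnn> : Prop` per row of `conjectures/CONJECTURES.md`, typed EXACTLY (no paraphrase) in
the vocabulary of typer-1's `Defs.lean` / `Graph.lean` and of `Partition.lean`:

* `G : MultiGraph V E` with `E` finite, edge probabilities `p : E → ℝ` with `IsProb p`
  (every `p e ∈ [0, 1]`); `V` is arbitrary (only the finitely many edges matter, vertices not
  touched by an edge are isolated).
* marked vertices are pairwise distinct (the engine requires distinct marked vertices), written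
  `[a, b, c, d].Nodup`; `P(a~b ∧ c~d ∧ a≁c)` is
  `prob p (G.connEvent a b ∩ G.connEvent c d ∩ G.sepEvent a c)` (engine `&` = `∩`, `|` = `∪`,
  `not` = `ᶜ`, `sep a b` = `G.sepEvent a b = (G.connEvent a b)ᶜ`).
* partition-law rows use `G.partitionSetoidEvent m σ` with `σ : Setoid (Fin k)` in the refinement
  order (`σ ⊔ τ` = join, `σ ⊓ τ` = meet, as in PLAN.md §0).

Each `def` is a statement only; the lead's status of the row is recorded in the docstring
(`KILLED` rows keep their statement so that the witness can be checked in Lean).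
-/

namespace PercRepro

open MultiGraph

/-- **C-001** (lead seed hypothesis H1, status KILLED — `conjectures/KILLED.md`: n = 4, k = 4,
18/2460 violations; witness `K_{2,2}` + edge, all `p = 1/2`, `σ = abc|d`, `τ = abd|c`):
lattice log-supermodularity of the partition law,
`π(σ ∨ τ) · π(σ ∧ τ) ≥ π(σ) · π(τ)` for all partitions `σ, τ` of the marked set. -/
def C001 : Prop :=
  ∀ {V E : Type} [Fintype E] [DecidableEq E] (G : MultiGraph V E) (p : E → ℝ), IsProb p →
    ∀ {k : ℕ} (m : Fin k → V), Function.Injective m → ∀ σ τ : Setoid (Fin k),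
      prob p (G.partitionSetoidEvent m σ) * prob p (G.partitionSetoidEvent m τ) ≤
        prob p (G.partitionSetoidEvent m (σ ⊔ τ)) * prob p (G.partitionSetoidEvent m (σ ⊓ τ))

/-- **C-002** (lead seed hypothesis H2, status: hypothesis, untested): conditional negative
correlation of disjoint connections, `k = 4`,
`P(a~b ∧ c~d ∧ a≁c) · P(a≁c) ≤ P(a~b ∧ a≁c) · P(c~d ∧ a≁c)`. -/
def C002 : Prop :=
  ∀ {V E : Type} [Fintype E] [DecidableEq E] (G : MultiGraph V E) (p : E → ℝ), IsProb p →
    ∀ a b c d : V, [a, b, c, d].Nodup →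
      prob p (G.connEvent a b ∩ G.connEvent c d ∩ G.sepEvent a c) * prob p (G.sepEvent a c) ≤
        prob p (G.connEvent a b ∩ G.sepEvent a c) * prob p (G.connEvent c d ∩ G.sepEvent a c)

/-- **C-003** (lead seed hypothesis H3, status: known theorem, van den Berg–Kahn 2001,
calibration row): conditional FKG, `k = 4`,
`P(s~a ∧ s~b ∧ s≁t) · P(s≁t) ≥ P(s~a ∧ s≁t) · P(s~b ∧ s≁t)`. -/
def C003 : Prop :=
  ∀ {V E : Type} [Fintype E] [DecidableEq E] (G : MultiGraph V E) (p : E → ℝ), IsProb p →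
    ∀ s a b t : V, [s, a, b, t].Nodup →
      prob p (G.connEvent s a ∩ G.sepEvent s t) * prob p (G.connEvent s b ∩ G.sepEvent s t) ≤
        prob p (G.connEvent s a ∩ G.connEvent s b ∩ G.sepEvent s t) * prob p (G.sepEvent s t)

/-- **H4** (lead's PLANTED CONTROL, FALSE — `conjectures/KILLED.md`: fails on `C_4` with `a`, `c`
opposite and all `p = 1/10`): `P(a~b~c)² ≥ P(a~b) · P(b~c) · P(a~c)`. Typed so that the Lean side
of the pipeline can refute it (`¬ H4`). -/
def H4 : Prop :=
  ∀ {V E : Type} [Fintype E] [DecidableEq E] (G : MultiGraph V E) (p : E → ℝ), IsProb p →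
    ∀ a b c : V, [a, b, c].Nodup →
      prob p (G.connEvent a b) * prob p (G.connEvent b c) * prob p (G.connEvent a c) ≤
        prob p (G.connEvent a b ∩ G.connEvent b c) ^ 2

/-- **C-002 in conditional form**: `P(a~b ∧ c~d | a≁c) ≤ P(a~b | a≁c) · P(c~d | a≁c)` whenever
`P(a≁c) > 0` (when `P(a≁c) = 0` the product-form row holds trivially). -/
theorem C002_iff_cond : C002 ↔
    ∀ {V E : Type} [Fintype E] [DecidableEq E] (G : MultiGraph V E) (p : E → ℝ), IsProb p →
      ∀ a b c d : V, [a, b, c, d].Nodup → 0 < prob p (G.sepEvent a c) →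
        condProb p (G.connEvent a b ∩ G.connEvent c d) (G.sepEvent a c) ≤
          condProb p (G.connEvent a b) (G.sepEvent a c) *
            condProb p (G.connEvent c d) (G.sepEvent a c) := by
  constructor
  · intro h V E _ _ G p hp a b c d hn hs
    exact (condProb_inter_le_mul_iff hs).2 (h G p hp a b c d hn)
  · intro h V E _ _ G p hp a b c d hn
    rcases (prob_nonneg hp (G.sepEvent a c)).lt_or_eq with hs | hs
    · exact (condProb_inter_le_mul_iff hs).1 (h G p hp a b c d hn hs)
    · rw [← hs, mul_zero]
      exact mul_nonneg (prob_nonneg hp _) (prob_nonneg hp _)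

/-- **C-003 in conditional form** (van den Berg–Kahn 2001):
`P(s~a ∧ s~b | s≁t) ≥ P(s~a | s≁t) · P(s~b | s≁t)` whenever `P(s≁t) > 0`. -/
theorem C003_iff_cond : C003 ↔
    ∀ {V E : Type} [Fintype E] [DecidableEq E] (G : MultiGraph V E) (p : E → ℝ), IsProb p →
      ∀ s a b t : V, [s, a, b, t].Nodup → 0 < prob p (G.sepEvent s t) →
        condProb p (G.connEvent s a) (G.sepEvent s t) *
            condProb p (G.connEvent s b) (G.sepEvent s t) ≤
          condProb p (G.connEvent s a ∩ G.connEvent s b) (G.sepEvent s t) := by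
  constructor
  · intro h V E _ _ G p hp s a b t hn hs
    exact (mul_condProb_le_condProb_inter_iff hs).2 (h G p hp s a b t hn)
  · intro h V E _ _ G p hp s a b t hn
    rcases (prob_nonneg hp (G.sepEvent s t)).lt_or_eq with hs | hs
    · exact (mul_condProb_le_condProb_inter_iff hs).1 (h G p hp s a b t hn hs)
    · have h1 : prob p (G.connEvent s a ∩ G.sepEvent s t) ≤ 0 := by
        rw [hs]
        exact prob_mono hp Set.inter_subset_right
      have h2 := prob_nonneg hp (G.connEvent s a ∩ G.sepEvent s t)
      rw [le_antisymm h1 h2, zero_mul]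
      exact mul_nonneg (prob_nonneg hp _) (prob_nonneg hp _)

/-- **C-004** (p4, 2026-08-22T01:19Z; PLAN.md §0b: REDISCOVERED — Gladkov 2023 Cor 4.2, proof
independent, `proofs/P4-pairsum.md` Thm 1): the **pair-sum inequality** for three distinct marked
vertices `a, b, c`, `x·z ≥ y₁y₂ + y₁y₃ + y₂y₃`, where, in the engine's law rows (restricted-growth
strings on the marked line `a b c`), `x = π(000) = P(a~b~c)`, `y₁ = π(001) = P(ab|c)`,
`y₂ = π(010) = P(ac|b)`, `y₃ = π(011) = P(bc|a)`, `z = π(012) = P(a|b|c)`. Census (engine drop 1):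
0/3594 violations (p4), 0/104,280 (lead, n ≤ 6, 8 palettes + 3 uniform). -/
def C004 : Prop :=
  ∀ {V E : Type} [Fintype E] [DecidableEq E] (G : MultiGraph V E) (p : E → ℝ), IsProb p →
    ∀ a b c : V, [a, b, c].Nodup →
      prob p (G.partitionEvent ![a, b, c] ![0, 0, 1]) * prob p (G.partitionEvent ![a, b, c] ![0, 1, 0]) +
        prob p (G.partitionEvent ![a, b, c] ![0, 0, 1]) * prob p (G.partitionEvent ![a, b, c] ![0, 1, 1]) +
        prob p (G.partitionEvent ![a, b, c] ![0, 1, 0]) * prob p (G.partitionEvent ![a, b, c] ![0, 1, 1]) ≤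
      prob p (G.partitionEvent ![a, b, c] ![0, 0, 0]) * prob p (G.partitionEvent ![a, b, c] ![0, 1, 2])

/-- C-004 in connection-event form (the five rows rewritten by `partitionEvent_row_*`):
`P(a~b ∧ a≁c)·P(a~c ∧ a≁b) + P(a~b ∧ a≁c)·P(b~c ∧ a≁b) + P(a~c ∧ a≁b)·P(b~c ∧ a≁b)
  ≤ P(a~b ∧ b~c)·P(a≁b ∧ a≁c ∧ b≁c)`. -/
def C004conn : Prop :=
  ∀ {V E : Type} [Fintype E] [DecidableEq E] (G : MultiGraph V E) (p : E → ℝ), IsProb p →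
    ∀ a b c : V, [a, b, c].Nodup →
      prob p (G.connEvent a b ∩ G.sepEvent a c) * prob p (G.connEvent a c ∩ G.sepEvent a b) +
        prob p (G.connEvent a b ∩ G.sepEvent a c) * prob p (G.connEvent b c ∩ G.sepEvent a b) +
        prob p (G.connEvent a c ∩ G.sepEvent a b) * prob p (G.connEvent b c ∩ G.sepEvent a b) ≤
      prob p (G.connEvent a b ∩ G.connEvent b c) *
        prob p (G.sepEvent a b ∩ G.sepEvent a c ∩ G.sepEvent b c)

/-- The two forms of C-004 are the same statement. -/
theorem C004_iff_C004conn : C004 ↔ C004conn := by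
  constructor
  · intro h V E _ _ G p hp a b c hn
    have := h G p hp a b c hn
    rwa [G.partitionEvent_row_abc, G.partitionEvent_row_ab_c, G.partitionEvent_row_ac_b,
      G.partitionEvent_row_bc_a, G.partitionEvent_row_a_b_c] at this
  · intro h V E _ _ G p hp a b c hn
    rw [G.partitionEvent_row_abc, G.partitionEvent_row_ab_c, G.partitionEvent_row_ac_b,
      G.partitionEvent_row_bc_a, G.partitionEvent_row_a_b_c]
    exact h G p hp a b c hn

/-- **C-005** (lead, 2026-08-22T01:35–01:45Z, `conjectures/C-005.md`; ASSIGNMENTS v3 T2 target): the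
`k = 4` **crossing pair-sum inequality** `top·bot ≥ x₁x₂ + x₁x₃ + x₂x₃` for four marked vertices
`a, b, c, d`, in the engine's law rows (restricted-growth strings on the marked line `a b c d`):
`top = π(0000) = P(a~b~c~d)`, `bot = π(0123) = P(a|b|c|d)`, `x₁ = π(0011) = P(ab|cd)`,
`x₂ = π(0101) = P(ac|bd)`, `x₃ = π(0110) = P(ad|bc)`. Census: 0/205,686 (all graphs n ≤ 7, two
implementations); NOT pairwise-SMC (`not_SMC4_A_C005`, SMC.lean), not a K8 instance, the factor-3
sharpening of its three AD instances (p3: `ad_cross₁₂/₁₃/₂₃`, `C005_weak`). Event form: p3's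
`C005conn` (`topEvent`, `botEvent`, `crossEvent₁/₂/₃`, lean-drafts/p3/C005.lean). No distinctness
hypothesis (for coinciding vertices both sides vanish or the right side is `0`). -/
def C005 : Prop :=
  ∀ {V E : Type} [Fintype E] [DecidableEq E] (G : MultiGraph V E) (p : E → ℝ), IsProb p →
    ∀ a b c d : V,
      prob p (G.partitionEvent ![a, b, c, d] ![0, 0, 1, 1]) *
          prob p (G.partitionEvent ![a, b, c, d] ![0, 1, 0, 1]) +
        prob p (G.partitionEvent ![a, b, c, d] ![0, 0, 1, 1]) *
          prob p (G.partitionEvent ![a, b, c, d] ![0, 1, 1, 0]) +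
        prob p (G.partitionEvent ![a, b, c, d] ![0, 1, 0, 1]) *
          prob p (G.partitionEvent ![a, b, c, d] ![0, 1, 1, 0]) ≤
      prob p (G.partitionEvent ![a, b, c, d] ![0, 0, 0, 0]) *
        prob p (G.partitionEvent ![a, b, c, d] ![0, 1, 2, 3])

/-- **C-007** (mine-4, 2026-08-22T01:57Z, `conjectures/MINE-4.md` PS-S6; CONJECTURES.md v5: MINED,
needs N vs the degree-3 cone, LIT, ADV): the CUBIC sharpening of C-004 at `k = 3`,
`(x + z)·(xz − y₁y₂ − y₁y₃ − y₂y₃) ≥ y₁y₂y₃`, engine rows as in `C004`: `x = π(000)`, `y₁ = π(001)`,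
`y₂ = π(010)`, `y₃ = π(011)`, `z = π(012)`. Strictly stronger than C-004 whenever `x + z > 0`
(`x + z ≤ 1`, the rows being disjoint; C-004 itself is p5's theorem `C004_holds`); constant `1`
sharp (triangle, `p → 0`; 3-star with unmarked centre, `p → 1`). Census 0/358,260 (n = 7 exhaustive,
mine-4) + 0/162,912 (writer, second implementation); not a consequence of K1 + C-004 (pseudo-law
`(34,19,19,19,34)/125`). -/
def C007 : Prop :=
  ∀ {V E : Type} [Fintype E] [DecidableEq E] (G : MultiGraph V E) (p : E → ℝ), IsProb p →
    ∀ a b c : V,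
      prob p (G.partitionEvent ![a, b, c] ![0, 0, 1]) * prob p (G.partitionEvent ![a, b, c] ![0, 1, 0]) *
          prob p (G.partitionEvent ![a, b, c] ![0, 1, 1]) ≤
      (prob p (G.partitionEvent ![a, b, c] ![0, 0, 0]) + prob p (G.partitionEvent ![a, b, c] ![0, 1, 2])) *
        (prob p (G.partitionEvent ![a, b, c] ![0, 0, 0]) * prob p (G.partitionEvent ![a, b, c] ![0, 1, 2]) -
          (prob p (G.partitionEvent ![a, b, c] ![0, 0, 1]) * prob p (G.partitionEvent ![a, b, c] ![0, 1, 0]) +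
            prob p (G.partitionEvent ![a, b, c] ![0, 0, 1]) * prob p (G.partitionEvent ![a, b, c] ![0, 1, 1]) +
            prob p (G.partitionEvent ![a, b, c] ![0, 1, 0]) * prob p (G.partitionEvent ![a, b, c] ![0, 1, 1])))

/-! ### Classical cone, named (PLAN.md §1) -/

/-- **(K2) BK in partition form, simplest instance** (PLAN.md §1 example):
`P(a~b ∧ c~d ∧ a≁c) ≤ P(a~b) · P(c~d)`. Stated as a named Prop; it follows from the BK inequality
(`BKInequality E`) once the disjoint-occurrence witness is supplied. -/
def K2_example : Prop :=
  ∀ {V E : Type} [Fintype E] [DecidableEq E] (G : MultiGraph V E) (p : E → ℝ), IsProb p →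
    ∀ a b c d : V, [a, b, c, d].Nodup →
      prob p (G.connEvent a b ∩ G.connEvent c d ∩ G.sepEvent a c) ≤ prob p (G.connEvent a b) * prob p (G.connEvent c d)

/-- C-002 implies the BK instance `K2_example` (the row's "nearest classical inequality" column):
`P(a~b ∧ c~d ∧ a≁c) · P(a≁c) ≤ P(a~b ∧ a≁c) · P(c~d ∧ a≁c) ≤ P(a~b) P(a≁c) · P(c~d)` by the mixed
Harris inequality (`a~b` increasing, `a≁c` decreasing) and monotonicity; divide by `P(a≁c)` when
it is positive (when it is `0` the left side is `0`). -/
theorem K2_example_of_C002 (h : C002) : K2_example := by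
  intro V E _ _ G p hp a b c d hn
  have h1 := h G p hp a b c d hn
  have hH : prob p (G.connEvent a b ∩ G.sepEvent a c) ≤ prob p (G.connEvent a b) * prob p (G.sepEvent a c) :=
    harris_upper_lower hp (G.isUpperSet_connEvent a b) (G.isLowerSet_sepEvent a c)
  have hB := prob_mono hp (Set.inter_subset_left : G.connEvent c d ∩ G.sepEvent a c ⊆ G.connEvent c d)
  have hs0 := prob_nonneg hp (G.sepEvent a c)
  have hcd0 := prob_nonneg hp (G.connEvent c d ∩ G.sepEvent a c)
  have hab1 := prob_nonneg hp (G.connEvent a b)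
  have hcd1 := prob_nonneg hp (G.connEvent c d)
  by_cases hz : prob p (G.sepEvent a c) = 0
  · have hX : prob p (G.connEvent a b ∩ G.connEvent c d ∩ G.sepEvent a c) ≤ 0 := by
      rw [← hz]
      exact prob_mono hp Set.inter_subset_right
    exact hX.trans (mul_nonneg hab1 hcd1)
  · have hpos : 0 < prob p (G.sepEvent a c) := lt_of_le_of_ne hs0 (Ne.symm hz)
    have h2 : prob p (G.connEvent a b ∩ G.connEvent c d ∩ G.sepEvent a c) * prob p (G.sepEvent a c) ≤
        prob p (G.connEvent a b) * prob p (G.connEvent c d) * prob p (G.sepEvent a c) := by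
      calc prob p (G.connEvent a b ∩ G.connEvent c d ∩ G.sepEvent a c) * prob p (G.sepEvent a c)
          ≤ prob p (G.connEvent a b ∩ G.sepEvent a c) * prob p (G.connEvent c d ∩ G.sepEvent a c) := h1
        _ ≤ prob p (G.connEvent a b) * prob p (G.sepEvent a c) * prob p (G.connEvent c d ∩ G.sepEvent a c) :=
            mul_le_mul_of_nonneg_right hH hcd0
        _ ≤ prob p (G.connEvent a b) * prob p (G.sepEvent a c) * prob p (G.connEvent c d) :=
            mul_le_mul_of_nonneg_left hB (mul_nonneg hab1 hs0)
        _ = prob p (G.connEvent a b) * prob p (G.connEvent c d) * prob p (G.sepEvent a c) := by ring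
    exact le_of_mul_le_mul_right h2 hpos

end PercRepro
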